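import Literature.AlgebraicGeometry.HodgeTheory.MotivatedClassesDeformationInputs
import Literature.AlgebraicGeometry.HodgeTheory.AlgebraicityLocus
import Literature.AlgebraicGeometry.Motives.VarietiesDimensionProofs
import Mathlib.Topology.Algebra.Module.Cardinality

/-!
# Route AnchorTransport — `VariationalHodge` (stmt-HodgeConjecture-1076): curve bases are thick; the dominance form of the crux over a curve

After the reductions of `AnchorTransportVariationalHodgeReductions` (affine bases) and of the curve-base
reduction (smooth irreducible affine CURVE bases, granted Mumford's lemma), every line on the crux
`AnchorTransport.VariationalHodge` works over a smooth irreducible affine curve `C`, and closes up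
from "algebraic at many points" to "algebraic at every point" by the closing lemma
(`variationalHodge_closing_of_thickSet` of `AnchorTransportVariationalHodgeClosing`, restated here as
`mem_algebraicClasses_of_thickSet` from the named fact `charlesSchnell_algebraicityLocus_iUnion_closed`
so as not to depend on the route cone), whose thickness hypotheses this file DISCHARGES for curve bases:

* `finite_of_isClosed_ne_univ_of_topologicalKrullDim_le_one` — a proper closed subset of an
  irreducible Noetherian sober space of Krull dimension `≤ 1` (e.g. a proper closed subset of an
  irreducible curve) is FINITE: each of its finitely many irreducible components is a point, for a
  second point would give a chain `{x}⁻ ⊊ T ⊊ C` of irreducible closed subsets of length `2`;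
* `finite_setOf_pt_mem` — hence only finitely many complex points lie over it (complex points of a
  `ℂ`-scheme locally of finite type are determined by their closed points,
  `ComplexPoints.equivClosedPoints`);
* `not_countable_complexPoints` — the complex points of a non-empty `ℂ`-scheme smooth of positive
  relative dimension are UNCOUNTABLE (a chart of the `2n`-manifold `X(ℂ)`,
  `Motives.ComplexPoints.chartedSpace`, has a non-empty open target in `ℝ²ⁿ`, and countable subsets
  of `ℝ²ⁿ` have dense complement, Mathlib `Set.Countable.dense_compl`);
* `curve_not_subset_iUnion_of_cofinite` — THICKNESS: on a smooth irreducible affine curve `C`, no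
  set of complex points with finite complement — in particular neither `C(ℂ)` itself nor the complex
  points over a non-empty Zariski open — is contained in a countable union of complex-point sets of
  proper Zariski-closed subsets;
* `variationalHodge_curve_dominance` — **the dominance form of the crux over a curve base**:
  granted `charlesSchnell_algebraicityLocus_iUnion_closed`, for a smooth projective family
  `f : 𝒳 ⟶ C` with `𝒳` quasi-projective over a smooth irreducible affine curve `C` (quasi-projective
  by `IsQuasiProjectiveOver.of_isAffine` once available; here a hypothesis) and a global class `A`,
  if `A|_{𝒳_t}` is algebraic for all complex `t` over a non-empty Zariski open `U ⊆ C` — or just for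
  all but finitely many `t` — then for ALL `t` (the input `DominanceFormOfV` / `AnalyticInteriorForcesAll`
  / `LocalToGlobal` of the idea cards `exact-reduced-dimension-transport`, `cusp-driven-log-transport`,
  `nodal-carrier-equisingular-transport`, `polar-patch-broken-cycles`, in the curve-base setting to
  which the crux reduces).
-/

noncomputable section

-- every declaration of this problem lives in `Summit.HodgeConjecture.HodgeConjecture.…` (summit = sub-problem)
set_option linter.dupNamespace false

open CategoryTheory AlgebraicGeometry TopologicalSpace
open Literature.AlgebraicGeometry.Motives Literature.AlgebraicGeometry.HodgeTheory

namespace Summit.HodgeConjecture.HodgeConjecture.Theorems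

/-! ### Proper closed subsets of a curve are finite -/

/-- **An irreducible closed proper subset of an irreducible sober space of Krull dimension `≤ 1` is
a single point**: if `T ⊊ X` is irreducible and closed with generic point `ζ`, any `x ∈ T` other than
`ζ` gives the chain `{x}⁻ ⊊ T ⊊ X` of irreducible closed subsets, of length `2 > 1`. [folklore] -/
theorem subsingleton_of_isIrreducible_isClosed_ne_univ {X : Type*} [TopologicalSpace X]
    [IrreducibleSpace X] [QuasiSober X] [T0Space X] (hdim : topologicalKrullDim X ≤ 1)
    {T : Set X} (hT : IsIrreducible T) (hTc : IsClosed T) (hne : T ≠ Set.univ) :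
    T.Subsingleton := by
  intro x hx y hy
  by_contra hxy
  -- one of `x`, `y` is not the generic point of `T`
  obtain ⟨z, hz, hzg⟩ : ∃ z ∈ T, z ≠ hT.genericPoint := by
    by_cases h : x = hT.genericPoint
    · exact ⟨y, hy, fun h' => hxy (h.trans h'.symm)⟩
    · exact ⟨x, hx, h⟩
  have hgen : IsGenericPoint hT.genericPoint T := by
    simpa only [hTc.closure_eq] using hT.isGenericPoint_genericPoint_closure
  -- the chain `{z}⁻ ⊊ T ⊊ univ` in `IrreducibleCloseds X`
  let A₀ : IrreducibleCloseds X := ⟨closure {z}, isIrreducible_singleton.closure, isClosed_closure⟩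
  let A₁ : IrreducibleCloseds X := ⟨T, hT, hTc⟩
  let A₂ : IrreducibleCloseds X := ⟨Set.univ, IrreducibleSpace.isIrreducible_univ X, isClosed_univ⟩
  have h₀₁ : A₀ < A₁ := by
    refine lt_of_le_of_ne (closure_minimal (Set.singleton_subset_iff.2 hz) hTc) fun h => hzg ?_
    have hz' : IsGenericPoint z T := by
      have : (A₀ : Set X) = A₁ := congrArg (fun A : IrreducibleCloseds X => (A : Set X)) h
      exact this
    exact hz'.eq hgen
  have h₁₂ : A₁ < A₂ := lt_of_le_of_ne (Set.subset_univ _) fun h => hne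
    (congrArg (fun A : IrreducibleCloseds X => (A : Set X)) h)
  let l : LTSeries (IrreducibleCloseds X) :=
    { length := 2
      toFun := ![A₀, A₁, A₂]
      step := fun i => by
        fin_cases i
        · simpa using h₀₁
        · simpa using h₁₂ }
  have h2 : ((2 : ℕ) : WithBot ℕ∞) ≤ topologicalKrullDim X := Order.le_krullDim_iff.2 ⟨l, rfl⟩
  have h21 : ((2 : ℕ) : WithBot ℕ∞) ≤ (1 : ℕ) := by simpa using h2.trans hdim
  exact absurd h21 (by exact_mod_cast (by norm_num : ¬ (2 ≤ 1)))

/-- **A proper closed subset of an irreducible Noetherian sober space of Krull dimension `≤ 1` is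
finite** — e.g. a proper Zariski-closed subset of an irreducible curve: it is the union of finitely
many irreducible closed subsets (Mathlib `NoetherianSpace.exists_finset_irreducible`), each a point
(`subsingleton_of_isIrreducible_isClosed_ne_univ`). [folklore] -/
theorem finite_of_isClosed_ne_univ_of_topologicalKrullDim_le_one {X : Type*} [TopologicalSpace X]
    [IrreducibleSpace X] [QuasiSober X] [T0Space X] [NoetherianSpace X]
    (hdim : topologicalKrullDim X ≤ 1) {W : Set X} (hW : IsClosed W) (hne : W ≠ Set.univ) :
    W.Finite := by
  obtain ⟨S, hS, hWS⟩ := NoetherianSpace.exists_finset_irreducible (⟨W, hW⟩ : Closeds X)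
  have hWeq : W = ⋃ k ∈ S, (k : Set X) := by
    have := congrArg (fun s : Closeds X => (s : Set X)) hWS
    simpa only [Closeds.coe_mk, Closeds.coe_finset_sup, Finset.sup_set_eq_biUnion, Function.comp_apply,
      id] using this
  have hsub : ∀ k ∈ S, (k : Set X) ⊆ W := fun k hk => hWeq ▸ Set.subset_biUnion_of_mem hk
  rw [hWeq]
  refine S.finite_toSet.biUnion fun k hk => Set.Subsingleton.finite ?_
  exact subsingleton_of_isIrreducible_isClosed_ne_univ hdim (hS ⟨k, hk⟩) k.isClosed fun hk' =>
    hne (Set.eq_univ_of_univ_subset (hk' ▸ hsub k hk))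

/-! ### Complex points over a finite set; uncountability of `X(ℂ)` -/

/-- **Complex points are determined by their closed points** (for a `ℂ`-scheme locally of finite
type: `ComplexPoints.equivClosedPoints`, the Nullstellensatz), so only finitely many complex points
lie over a finite set of scheme points. [folklore] -/
theorem finite_setOf_pt_mem {X : SchemeOver ℂ} [LocallyOfFiniteType X.hom] {W : Set X.left}
    (hW : W.Finite) : {t : ComplexPoints X | t.pt ∈ W}.Finite := by
  have hinj : Function.Injective (fun t : ComplexPoints X => t.pt) := fun P Q h =>
    (ComplexPoints.equivClosedPoints X).injective (Subtype.ext h)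
  exact hW.preimage hinj.injOn

/-- **The complex points of a non-empty `ℂ`-scheme smooth of positive relative dimension are
uncountable**: `X(ℂ)` is a topological `2n`-manifold (`Motives.ComplexPoints.chartedSpace`, Serre
GAGA §2), a chart has a non-empty open target in `ℝ²ⁿ`, `2n ≥ 2`, and a countable subset of a
non-trivial real vector space has dense complement (Mathlib `Set.Countable.dense_compl`), so cannot
be a non-empty open set. [cite: SerreGAGA1956, §2 n°5 Prop. 2 and n°6] -/
theorem not_countable_complexPoints {n : ℕ} (X : SchemeOver ℂ) [LocallyOfFiniteType X.hom]
    [SmoothOfRelativeDimension n X.hom] (hn : 1 ≤ n) [Nonempty (ComplexPoints X)] :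
    ¬ (Set.univ : Set (ComplexPoints X)).Countable := by
  intro hc
  letI := ComplexPoints.chartedSpace X n
  obtain ⟨P⟩ := ‹Nonempty (ComplexPoints X)›
  set e := chartAt (EuclideanSpace ℝ (Fin (2 * n))) P with he
  -- the target of the chart is a countable non-empty open subset of `ℝ²ⁿ`
  have htc : e.target.Countable := by
    rw [← e.image_source_eq_target]
    exact (hc.mono (Set.subset_univ _)).image _
  have hne : e.target.Nonempty := ⟨e P, e.map_source (mem_chart_source _ P)⟩
  haveI : Nonempty (Fin (2 * n)) := ⟨⟨0, by omega⟩⟩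
  haveI : Nontrivial (EuclideanSpace ℝ (Fin (2 * n))) := inferInstance
  obtain ⟨v, hvt, hvc⟩ := (htc.dense_compl ℝ).inter_open_nonempty _ e.open_target hne
  exact hvc hvt

/-! ### Thickness of curve bases -/

/-- **Smooth irreducible affine curves are thick against proper Zariski-closed subsets.** Let `C` be
a smooth irreducible affine `ℂ`-scheme of Krull dimension `1` and `Λ ⊆ C(ℂ)` a set of complex points
with FINITE complement (e.g. all of `C(ℂ)`, or the complex points over a non-empty Zariski open).
Then `Λ` is not contained in any countable union `⋃ₖ Zₖ(ℂ)` with all `Zₖ ⊊ C` Zariski-closed and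
proper: each `Zₖ(ℂ)` is finite (`finite_of_isClosed_ne_univ_of_topologicalKrullDim_le_one`,
`finite_setOf_pt_mem`), so `Λ`, and with it `C(ℂ)`, would be countable, whereas `C(ℂ)` is
uncountable (`not_countable_complexPoints`; `C` is smooth of relative dimension exactly `1` by
`topologicalKrullDim_eq_of_smoothOfRelativeDimension`). [folklore] -/
theorem curve_not_subset_iUnion_of_cofinite {C : SchemeOver ℂ} [IsAffine C.left]
    [IrreducibleSpace C.left] [AlgebraicGeometry.Smooth C.hom] (hdim : topologicalKrullDim C.left = 1)
    (Λ : Set (ComplexPoints C)) (hΛ : Λᶜ.Finite) (Z : ℕ → Set C.left) (hZc : ∀ k, IsClosed (Z k))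
    (hZne : ∀ k, Z k ≠ Set.univ) : ¬ Λ ⊆ ⋃ k, {t : ComplexPoints C | t.pt ∈ Z k} := by
  intro hsub
  -- instances on `C`: locally of finite type, Noetherian, connected complex points, relative dimension `1`
  haveI : IsLocallyNoetherian C.left := LocallyOfFiniteType.isLocallyNoetherian C.hom
  haveI : CompactSpace C.left := isCompact_univ_iff.mp (isAffineOpen_top C.left).isCompact
  haveI : IsNoetherian C.left := {}
  haveI : ConnectedSpace (ComplexPoints C) := (ComplexPoints.connectedSpace_iff_holds C).2 inferInstance
  obtain ⟨m, hm⟩ := exists_smoothOfRelativeDimension_of_connectedSpace_complexPoints C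
  haveI := hm
  have hm1 : 1 ≤ m := by
    have h := topologicalKrullDim_eq_of_smoothOfRelativeDimension C.hom m
    rw [hdim] at h
    have : (1 : WithBot ℕ∞) ≤ m := h.le
    exact_mod_cast this
  -- every `Zₖ(ℂ)` is finite, so `Λ` and `C(ℂ)` are countable
  have hfin : ∀ k, {t : ComplexPoints C | t.pt ∈ Z k}.Finite := fun k =>
    finite_setOf_pt_mem
      (finite_of_isClosed_ne_univ_of_topologicalKrullDim_le_one hdim.le (hZc k) (hZne k))
  have hΛc : Λ.Countable := (Set.countable_iUnion fun k => (hfin k).countable).mono hsub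
  have huniv : (Set.univ : Set (ComplexPoints C)).Countable := by
    rw [← Set.union_compl_self Λ]
    exact hΛc.union hΛ.countable
  exact not_countable_complexPoints C hm1 huniv

/-- The case `Λ = C(ℂ)`: a smooth irreducible affine curve is not a countable union of complex-point
sets of proper Zariski-closed subsets — the hypothesis `hthick` of `variationalHodge_closing_iff`
DISCHARGED for curve bases. [folklore] -/
theorem curve_univ_not_subset_iUnion {C : SchemeOver ℂ} [IsAffine C.left] [IrreducibleSpace C.left]
    [AlgebraicGeometry.Smooth C.hom] (hdim : topologicalKrullDim C.left = 1) (Z : ℕ → Set C.left)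
    (hZc : ∀ k, IsClosed (Z k)) (hZne : ∀ k, Z k ≠ Set.univ) :
    ¬ (Set.univ : Set (ComplexPoints C)) ⊆ ⋃ k, {t : ComplexPoints C | t.pt ∈ Z k} :=
  curve_not_subset_iUnion_of_cofinite hdim Set.univ (by simp) Z hZc hZne

/-- The case of a non-empty Zariski open `U ⊆ C`: the complex points over `U` have finite complement
(the complex points over the proper closed `C ∖ U`), hence are thick. [folklore] -/
theorem curve_setOf_pt_mem_open_not_subset_iUnion {C : SchemeOver ℂ} [IsAffine C.left]
    [IrreducibleSpace C.left] [AlgebraicGeometry.Smooth C.hom] (hdim : topologicalKrullDim C.left = 1)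
    {U : Set C.left} (hU : IsOpen U) (hUne : U.Nonempty) (Z : ℕ → Set C.left)
    (hZc : ∀ k, IsClosed (Z k)) (hZne : ∀ k, Z k ≠ Set.univ) :
    ¬ {t : ComplexPoints C | t.pt ∈ U} ⊆ ⋃ k, {t : ComplexPoints C | t.pt ∈ Z k} := by
  haveI : IsLocallyNoetherian C.left := LocallyOfFiniteType.isLocallyNoetherian C.hom
  haveI : CompactSpace C.left := isCompact_univ_iff.mp (isAffineOpen_top C.left).isCompact
  haveI : IsNoetherian C.left := {}
  refine curve_not_subset_iUnion_of_cofinite hdim _ ?_ Z hZc hZne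
  have hcompl : {t : ComplexPoints C | t.pt ∈ U}ᶜ = {t : ComplexPoints C | t.pt ∈ Uᶜ} := rfl
  rw [hcompl]
  refine finite_setOf_pt_mem
    (finite_of_isClosed_ne_univ_of_topologicalKrullDim_le_one hdim.le hU.isClosed_compl fun h => ?_)
  obtain ⟨u, hu⟩ := hUne
  have : u ∈ Uᶜ := h ▸ Set.mem_univ u
  exact this hu

/-! ### The dominance form of the crux over a curve base -/

/-- **Closing from a thick set** (the closing lemma, restated here from the named fact so that this
file does not depend on the route cone; cf. `variationalHodge_closing_of_thickSet` of
`AnchorTransportVariationalHodgeClosing`): granted `charlesSchnell_algebraicityLocus_iUnion_closed`,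
for a smooth projective family `f : 𝒳 ⟶ S` with `𝒳`, `S` quasi-projective and `S` smooth, if the
fibre restrictions of a global class `A` are algebraic on a set `Λ ⊆ S(ℂ)` not contained in any
countable union of complex-point sets of proper Zariski-closed subsets, they are algebraic at every
complex point. [cite: CharlesSchnell2014Notes, Prop. 11.3.11 (proof)] -/
theorem mem_algebraicClasses_of_thickSet (hCS : charlesSchnell_algebraicityLocus_iUnion_closed)
    {n p : ℕ} {𝒳 S : SchemeOver ℂ} (f : 𝒳 ⟶ S) (hf : IsSmoothProjectiveFamily f n)
    (h𝒳 : IsQuasiProjectiveOver 𝒳) (hS : IsQuasiProjectiveOver S) (hsm : AlgebraicGeometry.Smooth S.hom)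
    (A : complexBetti 𝒳 (2 * p)) (Λ : Set (ComplexPoints S))
    (hΛ : ∀ Z : ℕ → Set S.left, (∀ k, IsClosed (Z k)) → (∀ k, Z k ≠ Set.univ) →
      ¬ Λ ⊆ ⋃ k, {t : ComplexPoints S | t.pt ∈ Z k})
    (halg : ∀ t ∈ Λ, complexBetti.map (fiberι f t) (2 * p) A ∈ algebraicClasses (fiberOver f t) p)
    (t : ComplexPoints S) :
    complexBetti.map (fiberι f t) (2 * p) A ∈ algebraicClasses (fiberOver f t) p := by
  obtain ⟨W, hWc, hW⟩ := hCS f n p h𝒳 hS hsm hf A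
  by_cases huniv : ∃ j, W j = Set.univ
  · obtain ⟨j, hj⟩ := huniv
    have ht : t ∈ ⋃ j, {t : ComplexPoints S | t.pt ∈ W j} :=
      Set.mem_iUnion.2 ⟨j, by simp only [Set.mem_setOf_eq, hj, Set.mem_univ]⟩
    rw [← hW] at ht
    exact ht
  · push Not at huniv
    exact absurd (fun s hs => hW ▸ (halg s hs : s ∈ {t : ComplexPoints S |
      complexBetti.map (fiberι f t) (2 * p) A ∈ algebraicClasses (fiberOver f t) p})) (hΛ W hWc huniv)

/-- **Dominance form of the variational Hodge statement over a curve base.** Granted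
`charlesSchnell_algebraicityLocus_iUnion_closed`: let `f : 𝒳 ⟶ C` be a smooth projective family of
relative dimension `n` over a smooth irreducible affine CURVE `C` (Krull dimension `1`), with `𝒳` and
`C` quasi-projective over `ℂ`, and `A ∈ H²ᵖ(𝒳(ℂ); ℂ)` a global class. If `A|_{𝒳_t}` is algebraic for
every complex point `t` outside a FINITE set of complex points (e.g. for all `t` over a non-empty
Zariski open of `C`), then `A|_{𝒳_t}` is algebraic for EVERY `t`: the algebraicity locus is thick
(`curve_not_subset_iUnion_of_cofinite`), so the closing lemma applies. No rationality, Hodge-type or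
anchor hypothesis is needed beyond the cofinite algebraicity.
[cite: CharlesSchnell2014Notes, Prop. 11.3.11 (proof)] -/
theorem variationalHodge_curve_dominance (hCS : charlesSchnell_algebraicityLocus_iUnion_closed)
    {n p : ℕ} {𝒳 C : SchemeOver ℂ} (f : 𝒳 ⟶ C) (hf : IsSmoothProjectiveFamily f n)
    (h𝒳 : IsQuasiProjectiveOver 𝒳) (hC : IsQuasiProjectiveOver C) [IsAffine C.left]
    [IrreducibleSpace C.left] [AlgebraicGeometry.Smooth C.hom] (hdim : topologicalKrullDim C.left = 1)
    (A : complexBetti 𝒳 (2 * p)) (Λ : Set (ComplexPoints C)) (hΛ : Λᶜ.Finite)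
    (halg : ∀ t ∈ Λ, complexBetti.map (fiberι f t) (2 * p) A ∈ algebraicClasses (fiberOver f t) p)
    (t : ComplexPoints C) :
    complexBetti.map (fiberι f t) (2 * p) A ∈ algebraicClasses (fiberOver f t) p :=
  mem_algebraicClasses_of_thickSet hCS f hf h𝒳 hC ‹_› A Λ
    (fun Z hZc hZne => curve_not_subset_iUnion_of_cofinite hdim Λ hΛ Z hZc hZne) halg t

/-- **Dominance from a non-empty Zariski open**, the shape `DominanceFormOfV` of the idea cards, over
a curve base: algebraic at all complex points over a non-empty open `U ⊆ C` ⇒ algebraic everywhere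
(granted the Charles–Schnell fact; `𝒳`, `C` quasi-projective). [cite: CharlesSchnell2014Notes, Prop. 11.3.11 (proof)] -/
theorem variationalHodge_curve_dominance_of_open (hCS : charlesSchnell_algebraicityLocus_iUnion_closed)
    {n p : ℕ} {𝒳 C : SchemeOver ℂ} (f : 𝒳 ⟶ C) (hf : IsSmoothProjectiveFamily f n)
    (h𝒳 : IsQuasiProjectiveOver 𝒳) (hC : IsQuasiProjectiveOver C) [IsAffine C.left]
    [IrreducibleSpace C.left] [AlgebraicGeometry.Smooth C.hom] (hdim : topologicalKrullDim C.left = 1)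
    (A : complexBetti 𝒳 (2 * p)) {U : Set C.left} (hU : IsOpen U) (hUne : U.Nonempty)
    (halg : ∀ t : ComplexPoints C, t.pt ∈ U →
      complexBetti.map (fiberι f t) (2 * p) A ∈ algebraicClasses (fiberOver f t) p)
    (t : ComplexPoints C) :
    complexBetti.map (fiberι f t) (2 * p) A ∈ algebraicClasses (fiberOver f t) p :=
  mem_algebraicClasses_of_thickSet hCS f hf h𝒳 hC ‹_› A {t | t.pt ∈ U}
    (fun Z hZc hZne => curve_setOf_pt_mem_open_not_subset_iUnion hdim hU hUne Z hZc hZne)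
    (fun t ht => halg t ht) t

end Summit.HodgeConjecture.HodgeConjecture.Theorems

end
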